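import Summits.Ventures.YMGap.RobustBall.CentreBlindZ2Domination
import Literature.MathematicalPhysics.QuantumFieldTheory.Z2WilsonLoopGKSUpper
import HarnessLib

/-!
# RobustBall/CentreBlindZ2Perimeter — an ALL-COUPLING bound for the whole SU(2) centre-blind class:
# `|⟨W_{R×T}⟩_{β,W,L}| ≤ tanh(2(d−1)·β_W)^R` (and `^T`), `β_W = 2|β|`, at EVERY `β`, on every torus `L ≥ 2`

HONEST FRAMING: venture file of the cell `pub-ymgap` (QuantumFields programme), track Y2 ROBUST-BALL / DS seat ds-4 (g12).  WHAT THIS IS: the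
Mack–Petkova domination of the tree (`CentreBlindZ2Domination`: every Wilson loop of every twist-blind perturbation of the SU(2) Wilson action is
bounded by the same loop `z2Loop β_W` of ℤ₂ lattice gauge theory on the same torus) combined with the GKS FREEZING bound for ferromagnetic spin systems
(Literature `gksExpect_spinProduct_le_prod_tanh`: freeze every spin off a set `A₁` of loop links no two of which lie on a common plaquette; Chatterjee
2020, Lemma 7.2, `⟨W_γ⟩ ≤ (tanh 2(d−1)β)^{ℓ−ℓ₀}`), with `A₁` = the `R` bottom links of the rectangle (two parallel `i`-links never share a plaquette):
**`su2_abs_wilsonLoop_le_tanh_pow : IsTwistBlind W → i ≠ j → R ≤ L → (T : ZMod L) ≠ 0 → |⟨(1/2)tr U_{∂R×T}⟩_{β,W,L}| ≤ tanh(2(d−1)·2|β|)^R`**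
for EVERY tree coupling `β` (NO window), and the same with `T` (left links); `d = 4`: `tanh(6β_W)^{max(R,T)}`.  The sequel `CentreBlindZ2PerimeterTwoSides`
freezes off two sides at once (exponent `R + T − 1`).  So no member of the class can push
a Wilson loop above the Ising-gauge perimeter bound; at `R = T = 1`: every plaquette expectation of every member is `≤ tanh(2(d−1)β_W)`.
HONEST LABEL: a PERIMETER-type bound (exponent `max(R,T)`, not `RT`): it is NOT an area law and says nothing about confinement; `SU(2)` only; finite tori
`L ≥ 2`; nothing continuum / spectral / Clay.

References AS PRINTED: S. Chatterjee, Comm. Math. Phys. 377 (2020) 307–340, Lemma 7.2 [arXiv181109770]; G. Mack, V. B. Petkova, Ann. Phys. 123 (1979)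
442, §2 [MackPetkova1979]; S. Friedli, Y. Velenik (2017) §3.8.1 [FriedliVelenik2017].
-/

noncomputable section

open Finset
open scoped symmDiff
open Literature.MathematicalPhysics.QuantumLattice (fundamentalRep)
open Literature.MathematicalPhysics.QuantumFieldTheory
open Literature.Probability.LatticeModels (SpinConfig spinAt spinProduct gksExpect siteCoupling)

namespace Summit.Ventures.YMGap.RobustBall

namespace ZTwo

variable {d L : ℕ}

/-! ### Odd supports of injective families are images -/

/-- An odd support is contained in the image. [folklore] -/
theorem oddSupport_subset_image {α : Type*} [DecidableEq α] (s : Finset α) (g : α → Edge d L) : oddSupport s g ⊆ s.image g := by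
  induction s using Finset.induction_on with
  | empty => simp [oddSupport]
  | insert a s ha ih =>
    simp only [oddSupport] at ih ⊢
    rw [Finset.fold_insert ha, Finset.image_insert]
    intro e he
    rw [Finset.mem_symmDiff] at he
    rcases he with ⟨h1, -⟩ | ⟨h2, -⟩
    · rw [Finset.mem_singleton] at h1
      rw [h1]
      exact Finset.mem_insert_self _ _
    · exact Finset.mem_insert_of_mem (ih h2)

/-- The odd support of an INJECTIVE family is its image. [folklore] -/
theorem oddSupport_eq_image_of_injOn {α : Type*} [DecidableEq α] (s : Finset α) (g : α → Edge d L) (hg : Set.InjOn g s) :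
    oddSupport s g = s.image g := by
  induction s using Finset.induction_on with
  | empty => simp [oddSupport]
  | insert a s ha ih =>
    have hg' : Set.InjOn g s := hg.mono (by simp)
    have hna : g a ∉ s.image g := by
      intro h
      obtain ⟨b, hb, hgb⟩ := Finset.mem_image.1 h
      have hba : b = a := hg (by simp [hb]) (by simp) hgb
      exact ha (hba ▸ hb)
    simp only [oddSupport] at ih ⊢
    rw [Finset.fold_insert ha, ih hg', Finset.image_insert]
    ext e
    rw [Finset.mem_symmDiff, Finset.mem_singleton, Finset.mem_insert]
    constructor
    · rintro (⟨h, -⟩ | ⟨h, -⟩)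
      · exact Or.inl h
      · exact Or.inr h
    · rintro (h | h)
      · exact Or.inl ⟨h, h ▸ hna⟩
      · exact Or.inr ⟨h, fun h' => hna (h' ▸ h)⟩

/-! ### Lines of parallel links -/

/-- Every link of `lineLinks m n y` is `(y + r·e_m, m)` for some `r < n`. [folklore] -/
theorem exists_of_mem_lineLinks [NeZero L] {m : Fin d} {n : ℕ} {y : Site d L} {e : Edge d L} (he : e ∈ lineLinks m n y) :
    ∃ r < n, e = (y + Pi.single m ((r : ℕ) : ZMod L), m) := by
  obtain ⟨r, hr, hre⟩ := Finset.mem_image.1 (oddSupport_subset_image _ _ he)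
  exact ⟨r, Finset.mem_range.1 hr, hre.symm⟩

/-- Links of `lineLinks m n y` point in direction `m`. [folklore] -/
theorem snd_eq_of_mem_lineLinks [NeZero L] {m : Fin d} {n : ℕ} {y : Site d L} {e : Edge d L} (he : e ∈ lineLinks m n y) : e.2 = m := by
  obtain ⟨r, -, rfl⟩ := exists_of_mem_lineLinks he
  rfl

/-- `r ↦ (r : ZMod L)` is injective on `r < n ≤ L`. [folklore] -/
theorem natCast_zmod_injOn [NeZero L] {n : ℕ} (hn : n ≤ L) : Set.InjOn (fun r : ℕ => ((r : ℕ) : ZMod L)) (Finset.range n : Set ℕ) := by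
  intro r hr r' hr' h
  have hrL : r < L := lt_of_lt_of_le (Finset.mem_range.1 (Finset.mem_coe.1 hr)) hn
  have hr'L : r' < L := lt_of_lt_of_le (Finset.mem_range.1 (Finset.mem_coe.1 hr')) hn
  have h2 := (ZMod.natCast_eq_natCast_iff' r r' L).1 h
  rwa [Nat.mod_eq_of_lt hrL, Nat.mod_eq_of_lt hr'L] at h2

/-- For `n ≤ L` the parametrisation `r ↦ (y + r·e_m, m)` of a line is injective on `r < n`. [folklore] -/
theorem lineLinks_param_injOn [NeZero L] (m : Fin d) {n : ℕ} (hn : n ≤ L) (y : Site d L) :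
    Set.InjOn (fun r : ℕ => ((y + Pi.single m ((r : ℕ) : ZMod L), m) : Edge d L)) (Finset.range n : Set ℕ) := by
  intro r hr r' hr' h
  have h1 : (y + Pi.single m ((r : ℕ) : ZMod L) : Site d L) m = (y + Pi.single m ((r' : ℕ) : ZMod L) : Site d L) m := by
    have := congrArg Prod.fst h
    exact congrFun this m
  simp only [Pi.add_apply, Pi.single_eq_same, add_right_inj] at h1
  exact natCast_zmod_injOn hn hr hr' h1

/-- For `n ≤ L` the `n` links of a line are distinct: `lineLinks m n y` is the image and has `n` elements. [folklore] -/
theorem lineLinks_eq_image [NeZero L] (m : Fin d) {n : ℕ} (hn : n ≤ L) (y : Site d L) :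
    lineLinks m n y = (Finset.range n).image fun r : ℕ => ((y + Pi.single m ((r : ℕ) : ZMod L), m) : Edge d L) := by
  unfold lineLinks
  exact oddSupport_eq_image_of_injOn _ _ (lineLinks_param_injOn m hn y)

/-- For `n ≤ L`, `#(lineLinks m n y) = n`. [folklore] -/
theorem card_lineLinks [NeZero L] (m : Fin d) {n : ℕ} (hn : n ≤ L) (y : Site d L) : (lineLinks m n y).card = n := by
  rw [lineLinks_eq_image m hn y, Finset.card_image_of_injOn (lineLinks_param_injOn m hn y), Finset.card_range]

/-- **The bottom links lie in the loop's odd support** (`i ≠ j`, `T ≢ 0 mod L`): they are hit once by the bottom line and by no other side.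
[folklore] -/
theorem lineLinks_subset_loopLinks [NeZero L] {x : Site d L} {i j : Fin d} {R T : ℕ} (hij : i ≠ j) (hT : ((T : ℕ) : ZMod L) ≠ 0) :
    lineLinks i R x ⊆ loopLinks x i j R T := by
  intro e he
  have h2 : e.2 = i := snd_eq_of_mem_lineLinks he
  have hright : e ∉ lineLinks j T (x + Pi.single i ((R : ℕ) : ZMod L)) := fun h => hij (h2.symm.trans (snd_eq_of_mem_lineLinks h))
  have hleft : e ∉ lineLinks j T x := fun h => hij (h2.symm.trans (snd_eq_of_mem_lineLinks h))
  have htop : e ∉ lineLinks i R (x + Pi.single j ((T : ℕ) : ZMod L)) := by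
    intro h
    obtain ⟨r, -, hr⟩ := exists_of_mem_lineLinks he
    obtain ⟨r', -, hr'⟩ := exists_of_mem_lineLinks h
    have h1 := congrFun (congrArg Prod.fst (hr.symm.trans hr')) j
    simp only [Pi.add_apply, Pi.single_eq_same, Pi.single_eq_of_ne hij.symm, add_zero] at h1
    -- h1 : x j = x j + T  (or with zeros)
    apply hT
    have h3 : x j + ((T : ℕ) : ZMod L) = x j + 0 := by rw [add_zero]; exact h1.symm
    exact add_left_cancel h3
  unfold loopLinks
  rw [Finset.mem_symmDiff, Finset.mem_symmDiff, Finset.mem_symmDiff]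
  exact Or.inl ⟨Or.inl ⟨Or.inl ⟨he, hright⟩, htop⟩, hleft⟩

/-- **The left links lie in the loop's odd support** (`i ≠ j`, `R ≢ 0 mod L`). [folklore] -/
theorem lineLinks_left_subset_loopLinks [NeZero L] {x : Site d L} {i j : Fin d} {R T : ℕ} (hij : i ≠ j) (hR : ((R : ℕ) : ZMod L) ≠ 0) :
    lineLinks j T x ⊆ loopLinks x i j R T := by
  intro e he
  have h2 : e.2 = j := snd_eq_of_mem_lineLinks he
  have hbot : e ∉ lineLinks i R x := fun h => hij ((snd_eq_of_mem_lineLinks h).symm.trans h2)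
  have htop : e ∉ lineLinks i R (x + Pi.single j ((T : ℕ) : ZMod L)) := fun h => hij ((snd_eq_of_mem_lineLinks h).symm.trans h2)
  have hright : e ∉ lineLinks j T (x + Pi.single i ((R : ℕ) : ZMod L)) := by
    intro h
    obtain ⟨r, -, hr⟩ := exists_of_mem_lineLinks he
    obtain ⟨r', -, hr'⟩ := exists_of_mem_lineLinks h
    have h1 := congrFun (congrArg Prod.fst (hr.symm.trans hr')) i
    simp only [Pi.add_apply, Pi.single_eq_same, Pi.single_eq_of_ne hij, add_zero] at h1
    apply hR
    have h3 : x i + ((R : ℕ) : ZMod L) = x i + 0 := by rw [add_zero]; exact h1.symm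
    exact add_left_cancel h3
  unfold loopLinks
  rw [Finset.mem_symmDiff]
  refine Or.inr ⟨he, fun h => ?_⟩
  rw [Finset.mem_symmDiff, Finset.mem_symmDiff] at h
  rcases h with ⟨(⟨h1, -⟩ | ⟨h1, -⟩), -⟩ | ⟨h1, -⟩
  · exact hbot h1
  · exact hright h1
  · exact htop h1

/-! ### The plaquette supports are Chatterjee's four edges; two parallel links share no plaquette -/

/-- For `L ≥ 2` the odd support of the four links of a plaquette is the set of those (distinct) four links, i.e. the tree's `torusPlaqEdges`.
[folklore] -/
theorem plaqLinks_eq_torusPlaqEdges [NeZero L] [Fact (1 < L)] (p : Plaquette d L) : plaqLinks p = torusPlaqEdges p := by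
  obtain ⟨y, ⟨a, b⟩, hab⟩ := p
  have hne : a ≠ b := (show a < b from hab).ne
  have hsa := Literature.MathematicalPhysics.QuantumFieldTheory.Site.shift_ne_self y a
  have hsb := Literature.MathematicalPhysics.QuantumFieldTheory.Site.shift_ne_self y b
  have h1 : ((y.shift a, b) : Edge d L) ≠ (y, a) := fun h => hne.symm (congrArg Prod.snd h)
  have h2 : ((y.shift b, a) : Edge d L) ≠ (y, a) := fun h => hsb (congrArg Prod.fst h)
  have h3 : ((y.shift b, a) : Edge d L) ≠ (y.shift a, b) := fun h => hne (congrArg Prod.snd h)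
  have h4 : ((y, b) : Edge d L) ≠ (y, a) := fun h => hne.symm (congrArg Prod.snd h)
  have h5 : ((y, b) : Edge d L) ≠ (y.shift a, b) := fun h => hsa (congrArg Prod.fst h).symm
  have h6 : ((y, b) : Edge d L) ≠ (y.shift b, a) := fun h => hne.symm (congrArg Prod.snd h)
  have e1 : (({(y, a)} : Finset (Edge d L)) ∆ {(y.shift a, b)}) = {(y, a), (y.shift a, b)} := by
    rw [Disjoint.symmDiff_eq_sup (Finset.disjoint_singleton_right.2 (by rw [Finset.mem_singleton]; exact h1)), Finset.sup_eq_union]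
    simp only [Finset.insert_eq]
  have e2 : (({(y, a), (y.shift a, b)} : Finset (Edge d L)) ∆ {(y.shift b, a)}) = {(y, a), (y.shift a, b), (y.shift b, a)} := by
    rw [Disjoint.symmDiff_eq_sup (Finset.disjoint_singleton_right.2
      (by simp only [Finset.mem_insert, Finset.mem_singleton, not_or]; exact ⟨h2, h3⟩)), Finset.sup_eq_union]
    simp only [Finset.insert_eq, Finset.union_assoc]
  have e3 : (({(y, a), (y.shift a, b), (y.shift b, a)} : Finset (Edge d L)) ∆ {(y, b)}) =
      {(y, a), (y.shift a, b), (y.shift b, a), (y, b)} := by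
    rw [Disjoint.symmDiff_eq_sup (Finset.disjoint_singleton_right.2
      (by simp only [Finset.mem_insert, Finset.mem_singleton, not_or]; exact ⟨h4, h5, h6⟩)), Finset.sup_eq_union]
    simp only [Finset.insert_eq, Finset.union_assoc]
  simp only [plaqLinks, torusPlaqEdges]
  rw [e1, e2, e3]

/-- A link of a plaquette has, along its own direction, the coordinate of the plaquette's base point. [folklore] -/
theorem apply_snd_eq_of_mem_torusPlaqEdges {p : Plaquette d L} {e : Edge d L} (he : e ∈ torusPlaqEdges p) : e.1 e.2 = p.1 e.2 := by
  obtain ⟨z, ⟨a, b⟩, hab⟩ := p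
  have hne : a ≠ b := (show a < b from hab).ne
  simp only [torusPlaqEdges, Finset.mem_insert, Finset.mem_singleton] at he
  rcases he with rfl | rfl | rfl | rfl
  · rfl
  · show (z.shift a) b = z b
    simp [Literature.MathematicalPhysics.QuantumFieldTheory.Site.shift, Pi.single_eq_of_ne hne.symm]
  · show (z.shift b) a = z a
    simp [Literature.MathematicalPhysics.QuantumFieldTheory.Site.shift, Pi.single_eq_of_ne hne]
  · rfl

/-- **Two links of one line never lie on a common plaquette** (`L ≥ 2`): `#(plaqLinks p ∩ lineLinks m n y) ≤ 1`. [folklore] -/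
theorem card_plaqLinks_inter_lineLinks_le_one [NeZero L] [Fact (1 < L)] (p : Plaquette d L) (m : Fin d) (n : ℕ) (y : Site d L) :
    (plaqLinks p ∩ lineLinks m n y).card ≤ 1 := by
  rw [plaqLinks_eq_torusPlaqEdges]
  refine Finset.card_le_one.2 fun e he e' he' => ?_
  rw [Finset.mem_inter] at he he'
  obtain ⟨r, -, hr⟩ := exists_of_mem_lineLinks he.2
  obtain ⟨r', -, hr'⟩ := exists_of_mem_lineLinks he'.2
  have h2 : e.2 = m := by rw [hr]
  have h2' : e'.2 = m := by rw [hr']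
  have hm := apply_snd_eq_of_mem_torusPlaqEdges he.1
  have hm' := apply_snd_eq_of_mem_torusPlaqEdges he'.1
  rw [h2] at hm
  rw [h2'] at hm'
  refine Prod.ext ?_ (h2.trans h2'.symm)
  funext c
  by_cases hc : c = m
  · rw [hc, hm, hm']
  · rw [hr, hr']
    simp [Pi.single_eq_of_ne hc]

/-! ### The all-coupling bound -/

/-- **`z2Loop βW ≤ tanh(2(d−1)βW)^R`** (`βW ≥ 0`, `L ≥ 2`, `i ≠ j`, `R ≤ L`, `T ≢ 0 mod L`): GKS freezing of all link spins off the `R` bottom links.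
[cite: arXiv181109770, Lemma 7.2] -/
theorem z2Loop_le_tanh_pow [NeZero L] [Fact (1 < L)] {βW : ℝ} (hβ : 0 ≤ βW) {x : Site d L} {i j : Fin d} {R T : ℕ} (hij : i ≠ j)
    (hR : R ≤ L) (hT : ((T : ℕ) : ZMod L) ≠ 0) :
    z2Loop βW x i j R T ≤ Real.tanh (2 * (d - 1 : ℕ) * βW) ^ R := by
  classical
  have hfun : (plaqLinks : Plaquette d L → Finset (Edge d L)) = torusPlaqEdges := funext plaqLinks_eq_torusPlaqEdges
  have hsep : ∀ p ∈ (Finset.univ : Finset (Plaquette d L)), (torusPlaqEdges p ∩ lineLinks i R x).card ≤ 1 := fun p _ => by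
    rw [← plaqLinks_eq_torusPlaqEdges]; exact card_plaqLinks_inter_lineLinks_le_one p i R x
  unfold z2Loop
  rw [hfun]
  calc gksExpect (Finset.univ : Finset (Plaquette d L)) (fun _ => βW) torusPlaqEdges (spinProduct (loopLinks x i j R T))
      ≤ ∏ a ∈ lineLinks i R x, Real.tanh (siteCoupling (Finset.univ : Finset (Plaquette d L)) (fun _ => βW) torusPlaqEdges a) :=
        Literature.Probability.LatticeModels.gksExpect_spinProduct_le_prod_tanh _ _ _ (fun _ _ => hβ)
          (lineLinks_subset_loopLinks hij hT) hsep
    _ ≤ ∏ _a ∈ lineLinks i R x, Real.tanh (2 * (d - 1 : ℕ) * βW) := by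
        refine Finset.prod_le_prod (fun a _ => Literature.MathematicalPhysics.QuantumFieldTheory.tanh_nonneg (siteCoupling_torus_nonneg hβ a)) fun a _ => ?_
        exact Literature.MathematicalPhysics.QuantumFieldTheory.tanh_le_tanh (siteCoupling_torus_le hβ a)
    _ = Real.tanh (2 * (d - 1 : ℕ) * βW) ^ R := by rw [Finset.prod_const, card_lineLinks i hR x]

/-- **`z2Loop βW ≤ tanh(2(d−1)βW)^T`** (`βW ≥ 0`, `L ≥ 2`, `i ≠ j`, `T ≤ L`, `R ≢ 0 mod L`): freezing off the `T` left links.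
[cite: arXiv181109770, Lemma 7.2] -/
theorem z2Loop_le_tanh_pow_left [NeZero L] [Fact (1 < L)] {βW : ℝ} (hβ : 0 ≤ βW) {x : Site d L} {i j : Fin d} {R T : ℕ} (hij : i ≠ j)
    (hT : T ≤ L) (hR : ((R : ℕ) : ZMod L) ≠ 0) :
    z2Loop βW x i j R T ≤ Real.tanh (2 * (d - 1 : ℕ) * βW) ^ T := by
  classical
  have hfun : (plaqLinks : Plaquette d L → Finset (Edge d L)) = torusPlaqEdges := funext plaqLinks_eq_torusPlaqEdges
  have hsep : ∀ p ∈ (Finset.univ : Finset (Plaquette d L)), (torusPlaqEdges p ∩ lineLinks j T x).card ≤ 1 := fun p _ => by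
    rw [← plaqLinks_eq_torusPlaqEdges]; exact card_plaqLinks_inter_lineLinks_le_one p j T x
  unfold z2Loop
  rw [hfun]
  calc gksExpect (Finset.univ : Finset (Plaquette d L)) (fun _ => βW) torusPlaqEdges (spinProduct (loopLinks x i j R T))
      ≤ ∏ a ∈ lineLinks j T x, Real.tanh (siteCoupling (Finset.univ : Finset (Plaquette d L)) (fun _ => βW) torusPlaqEdges a) :=
        Literature.Probability.LatticeModels.gksExpect_spinProduct_le_prod_tanh _ _ _ (fun _ _ => hβ)
          (lineLinks_left_subset_loopLinks hij hR) hsep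
    _ ≤ ∏ _a ∈ lineLinks j T x, Real.tanh (2 * (d - 1 : ℕ) * βW) := by
        refine Finset.prod_le_prod (fun a _ => Literature.MathematicalPhysics.QuantumFieldTheory.tanh_nonneg (siteCoupling_torus_nonneg hβ a)) fun a _ => ?_
        exact Literature.MathematicalPhysics.QuantumFieldTheory.tanh_le_tanh (siteCoupling_torus_le hβ a)
    _ = Real.tanh (2 * (d - 1 : ℕ) * βW) ^ T := by rw [Finset.prod_const, card_lineLinks j hT x]

/-- **`z2Loop βW ≤ tanh(2(d−1)βW)^{max(R,T)}`** for a non-degenerate rectangle (`R, T ≤ L`, `R, T ≢ 0 mod L`, `i ≠ j`, `L ≥ 2`, `βW ≥ 0`).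
[cite: arXiv181109770, Lemma 7.2] -/
theorem z2Loop_le_tanh_pow_max [NeZero L] [Fact (1 < L)] {βW : ℝ} (hβ : 0 ≤ βW) {x : Site d L} {i j : Fin d} {R T : ℕ} (hij : i ≠ j)
    (hR : R ≤ L) (hT : T ≤ L) (hR0 : ((R : ℕ) : ZMod L) ≠ 0) (hT0 : ((T : ℕ) : ZMod L) ≠ 0) :
    z2Loop βW x i j R T ≤ Real.tanh (2 * (d - 1 : ℕ) * βW) ^ max R T := by
  rcases le_total R T with h | h
  · rw [max_eq_right h]; exact z2Loop_le_tanh_pow_left hβ hij hT hR0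
  · rw [max_eq_left h]; exact z2Loop_le_tanh_pow hβ hij hR hT0

/-- **ALL-COUPLING BOUND FOR THE CENTRE-BLIND CLASS** (`SU(2)`, every `d`, every torus `L ≥ 2`, EVERY tree coupling `β`, every twist-blind — in
particular every linkwise centre-blind — perturbation `W`, `i ≠ j`, `R ≤ L`, `T ≢ 0 mod L`):
`|⟨(1/2)tr U_{∂R×T}⟩_{β,W,L}| ≤ tanh(2(d−1)·2|β|)^R`.  HONEST LABEL: perimeter-type (exponent `R`), NOT an area law. [cite: arXiv181109770, Lemma 7.2] -/
theorem su2_abs_wilsonLoop_le_tanh_pow [NeZero L] [Fact (1 < L)] (W : Perturbation d L 2) (hW : IsTwistBlind W) (β : ℝ) {x : Site d L}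
    {i j : Fin d} {R T : ℕ} (hij : i ≠ j) (hR : R ≤ L) (hT : ((T : ℕ) : ZMod L) ≠ 0) :
    |W.expectation (fundamentalRep (Fin 2)) β (wilsonLoop (fundamentalRep (Fin 2)) x i j R T)| ≤
      Real.tanh (2 * (d - 1 : ℕ) * (2 * |β|)) ^ R :=
  su2_abs_wilsonLoop_le_of_z2Loop_le (z2Loop_le_tanh_pow (by positivity) hij hR hT) W hW

/-- The same for rb-theory's `IsCentreBlind`. [cite: arXiv181109770, Lemma 7.2] -/
theorem su2_abs_wilsonLoop_le_tanh_pow_of_isCentreBlind [NeZero L] [Fact (1 < L)] (W : Perturbation d L 2) (hW : IsCentreBlind W) (β : ℝ)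
    {x : Site d L} {i j : Fin d} {R T : ℕ} (hij : i ≠ j) (hR : R ≤ L) (hT : ((T : ℕ) : ZMod L) ≠ 0) :
    |W.expectation (fundamentalRep (Fin 2)) β (wilsonLoop (fundamentalRep (Fin 2)) x i j R T)| ≤
      Real.tanh (2 * (d - 1 : ℕ) * (2 * |β|)) ^ R :=
  su2_abs_wilsonLoop_le_tanh_pow W hW.isTwistBlind β hij hR hT

/-- **ALL-COUPLING BOUND, both sides**: `|⟨W_{R×T}⟩_{β,W,L}| ≤ tanh(2(d−1)·2|β|)^{max(R,T)}` for a non-degenerate rectangle (`R, T ≤ L`,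
`R, T ≢ 0 mod L`). [cite: arXiv181109770, Lemma 7.2] -/
theorem su2_abs_wilsonLoop_le_tanh_pow_max [NeZero L] [Fact (1 < L)] (W : Perturbation d L 2) (hW : IsTwistBlind W) (β : ℝ) {x : Site d L}
    {i j : Fin d} {R T : ℕ} (hij : i ≠ j) (hR : R ≤ L) (hT : T ≤ L) (hR0 : ((R : ℕ) : ZMod L) ≠ 0) (hT0 : ((T : ℕ) : ZMod L) ≠ 0) :
    |W.expectation (fundamentalRep (Fin 2)) β (wilsonLoop (fundamentalRep (Fin 2)) x i j R T)| ≤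
      Real.tanh (2 * (d - 1 : ℕ) * (2 * |β|)) ^ max R T :=
  su2_abs_wilsonLoop_le_of_z2Loop_le (z2Loop_le_tanh_pow_max (by positivity) hij hR hT hR0 hT0) W hW

/-- **ALL-COUPLING BOUND, currency shape** (every torus `L`, non-wrapping rectangle `1 ≤ R, T`, `2R, 2T ≤ L`, `i ≠ j`, every `β`, every twist-blind `W`):
`|⟨W_{R×T}⟩_{β,W,L}| ≤ tanh(2(d−1)·2|β|)^{max(R,T)}`. [cite: arXiv181109770, Lemma 7.2] -/
theorem su2_abs_wilsonLoop_le_tanh_pow_of_nonwrapping [NeZero L] (W : Perturbation d L 2) (hW : IsTwistBlind W) (β : ℝ) {x : Site d L}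
    {i j : Fin d} {R T : ℕ} (hij : i ≠ j) (hR1 : 1 ≤ R) (hT1 : 1 ≤ T) (hR : 2 * R ≤ L) (hT : 2 * T ≤ L) :
    |W.expectation (fundamentalRep (Fin 2)) β (wilsonLoop (fundamentalRep (Fin 2)) x i j R T)| ≤
      Real.tanh (2 * (d - 1 : ℕ) * (2 * |β|)) ^ max R T := by
  haveI : Fact (1 < L) := ⟨by omega⟩
  have hR0 : ((R : ℕ) : ZMod L) ≠ 0 := fun h =>
    absurd (Nat.le_of_dvd (by omega) ((ZMod.natCast_eq_zero_iff R L).1 h)) (by omega)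
  have hT0 : ((T : ℕ) : ZMod L) ≠ 0 := fun h =>
    absurd (Nat.le_of_dvd (by omega) ((ZMod.natCast_eq_zero_iff T L).1 h)) (by omega)
  exact su2_abs_wilsonLoop_le_tanh_pow_max W hW β hij (by omega) (by omega) hR0 hT0

/-- **SU(2), `d = 4`**: `|⟨W_{R×T}⟩_{β,W,L}| ≤ tanh(6·2|β|)^R = tanh(6 β_W)^R` for every twist-blind `W`, every `β`, `i ≠ j`, `R ≤ L`, `T ≢ 0 mod L`.
[cite: arXiv181109770, Lemma 7.2] -/
theorem su2_abs_wilsonLoop_le_tanh_pow_dim4 [NeZero L] [Fact (1 < L)] (W : Perturbation 4 L 2) (hW : IsTwistBlind W) (β : ℝ) {x : Site 4 L}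
    {i j : Fin 4} {R T : ℕ} (hij : i ≠ j) (hR : R ≤ L) (hT : ((T : ℕ) : ZMod L) ≠ 0) :
    |W.expectation (fundamentalRep (Fin 2)) β (wilsonLoop (fundamentalRep (Fin 2)) x i j R T)| ≤ Real.tanh (6 * (2 * |β|)) ^ R := by
  have h := su2_abs_wilsonLoop_le_tanh_pow W hW β (x := x) hij hR hT
  norm_num at h
  exact h

/-- **Every plaquette expectation of every member of the class is `≤ tanh(2(d−1)β_W)`** (`R = T = 1`, `L ≥ 2`, `i ≠ j`). [cite: arXiv181109770, Lemma 7.2] -/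
theorem su2_abs_plaquette_le_tanh [NeZero L] [Fact (1 < L)] (W : Perturbation d L 2) (hW : IsTwistBlind W) (β : ℝ) (x : Site d L)
    {i j : Fin d} (hij : i ≠ j) :
    |W.expectation (fundamentalRep (Fin 2)) β (wilsonLoop (fundamentalRep (Fin 2)) x i j 1 1)| ≤ Real.tanh (2 * (d - 1 : ℕ) * (2 * |β|)) := by
  have hL : 1 ≤ L := (Fact.out : 1 < L).le
  have h1 : ((1 : ℕ) : ZMod L) ≠ 0 := by
    rw [Nat.cast_one]
    exact one_ne_zero
  simpa using su2_abs_wilsonLoop_le_tanh_pow W hW β hij hL h1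

end ZTwo

end Summit.Ventures.YMGap.RobustBall

end
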